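import Summits.Schanuel.Schanuel.Theorems.ZilberEacTorusRuled
import Literature.ModelTheory.Zilber.EACGraphFibres
import Literature.ModelTheory.Zilber.EACSubcellCertificates
import HarnessLib

/-!
# Torus-ruled varieties, III: certified families and a model system over Mantova–Masser's base

Zilber's Exponential-Algebraic Closedness, case ladder (host summit Schanuel, cell `pub-schanuel`,
seat 2, gen 4).  Instances of the structural sub-rung `ZilberEacTorusRuled.lean` whose cell
membership is CERTIFIED by the typer's graph-fibre certificates (`EACGraphFibres`):

* the **monomial-fibre family** `W(g; A, κ) = {x_{s+1} = g(x'), yⱼ = Aⱼ(x') · y_{s+1}^{κⱼ}}`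
  (`graphFibreVariety g (monomialFibrePoly A κ)`): torus-ruled in the direction `(κ, 1)`
  (`isTorusStable_graphFibreVariety_monomial`); for `s ≥ 1`, `A` dominant and an APERIODIC graph
  base it is a certified member of `ECCellAperiodic s` and meets `Γ_exp`
  (`graphFibreVariety_monomial_inter_expGraph_nonempty`), i.e.
  `∃ x, e^{xⱼ} = Aⱼ(x) e^{κⱼ g(x)}` for all `j` (`exists_exp_eq_mul_exp_pow_of_aperiodic`) — with NO
  condition on the degree or the leading form of `g` and NO condition on the leading forms of `A`
  (contrast: the escape theorem `E_D^top` of gen 3 needs `deg g ≥ 2`, `g_D(κ) ≠ 0`,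
  `(Aⱼ)_top(κ) ≠ 0`);
* the **model over Mantova–Masser's base** `x₃ = x₁² - x₂²` with proportional fibres
  `y₁ = x₁ y₃`, `y₂ = x₂ y₃` (ruling direction `(1,1,1)`, ISOTROPIC for `x₁² - x₂²`, so outside every
  escape / puncture / oscillatory theorem of gens 1–3): `∃ z w, e^z = z·e^{z²-w²} ∧ e^w = w·e^{z²-w²}`
  (`mm_proportional_model_system_solvable`).

Honest framing: certified INSTANCES of the open cell's aperiodic piece, settled by the structural
theorem; `ECCell 3 2` stays OPEN; nothing here bears on Schanuel's conjecture; EAC ⇏ SC.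
-/

noncomputable section

open MvPolynomial Matrix
open Literature.NumberTheory.Transcendental Literature.ModelTheory.Zilber

set_option linter.dupNamespace false

namespace Summit.Schanuel.Schanuel.Theorems

variable {s : ℕ}

/-! ## Monomial fibres `yⱼ = Aⱼ(x') y_{s+1}^{κⱼ}` -/

/-- The fibre polynomials `Pⱼ(u, x') = Aⱼ(x') · u^{κⱼ}` (`u` = variable `0` = `y_{s+1}`, `xᵢ` =
variable `i + 1`, as in `graphFibreVariety`). [folklore] -/
def monomialFibrePoly (A : Fin s → MvPolynomial (Fin s) ℂ) (κ : Fin s → ℕ) :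
    Fin s → MvPolynomial (Fin (s + 1)) ℂ :=
  fun j => rename Fin.succ (A j) * X 0 ^ κ j

/-- The ruling direction `(κ₁, …, κ_s, 1) ∈ ℤ^{s+1}` of the monomial-fibre family. [folklore] -/
def monomialDir (κ : Fin s → ℕ) : Fin (s + 1) → ℤ :=
  Fin.snoc (fun j => (κ j : ℤ)) 1

/-- `monomialDir κ (castSucc j) = κⱼ`. [folklore] -/
@[simp] theorem monomialDir_castSucc (κ : Fin s → ℕ) (j : Fin s) :
    monomialDir κ (Fin.castSucc j) = κ j := by
  simp [monomialDir]

/-- `monomialDir κ (last) = 1`. [folklore] -/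
@[simp] theorem monomialDir_last (κ : Fin s → ℕ) : monomialDir κ (Fin.last s) = 1 := by
  simp [monomialDir]

/-- `monomialDir κ ≠ 0` (its last entry is `1`). [folklore] -/
theorem monomialDir_ne_zero (κ : Fin s → ℕ) : monomialDir κ ≠ 0 := by
  intro h
  have := congr_fun h (Fin.last s)
  rw [monomialDir_last] at this
  exact one_ne_zero this

variable (A : Fin s → MvPolynomial (Fin s) ℂ) (κ : Fin s → ℕ)

/-- Evaluation: `Pⱼ(u, x) = Aⱼ(x) u^{κⱼ}`. [folklore] -/
theorem eval_cons_monomialFibrePoly (u : ℂ) (x : Fin s → ℂ) (j : Fin s) :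
    eval (Fin.cons u x : Fin (s + 1) → ℂ) (monomialFibrePoly A κ j) = eval x (A j) * u ^ κ j := by
  simp only [monomialFibrePoly, map_mul, map_pow, eval_X, Fin.cons_zero, eval_rename, cons_comp_succ]

/-- The slice at height `u = 1` of the monomial fibres is `A` itself. [folklore] -/
theorem fibreSlice_monomialFibrePoly_one : fibreSlice (monomialFibrePoly A κ) 1 = A := by
  funext j
  simp only [fibreSlice, monomialFibrePoly, map_mul, map_pow, aeval_X, Fin.cons_zero, C_1, one_pow,
    mul_one, aeval_rename, cons_comp_succ, aeval_X_left_apply]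

/-- **The monomial-fibre family is torus-ruled** in the direction `(κ, 1)`: scaling
`y_{s+1} ↦ t y_{s+1}`, `yⱼ ↦ t^{κⱼ} yⱼ` preserves `yⱼ = Aⱼ(x') y_{s+1}^{κⱼ}`. [folklore] -/
theorem isTorusStable_graphFibreVariety_monomial (g : MvPolynomial (Fin s) ℂ) :
    IsTorusStable (monomialDir κ)
      (graphFibreVariety g (monomialFibrePoly A κ) ∩ torusLocus ℂ (s + 1)) := by
  rintro z ⟨hz, hzT⟩ t ht
  refine ⟨?_, torusScale_mem_torusLocus ht hzT⟩
  rw [mem_graphFibreVariety_iff] at hz ⊢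
  refine ⟨?_, fun j => ?_⟩
  · simpa only [torusScale_inl] using hz.1
  · rw [torusScale_inr, torusScale_inr, hz.2 j, monomialDir_castSucc, monomialDir_last]
    simp only [torusScale_inl, eval_cons_monomialFibrePoly, zpow_natCast, zpow_one]
    ring

/-- **The monomial-fibre family meets `Γ_exp` over every aperiodic graph base** (`s ≥ 1`, `A`
dominant): `W(g; A, κ) = {x_{s+1} = g(x'), yⱼ = Aⱼ(x') y_{s+1}^{κⱼ}}` is a certified member of
`ECCellAperiodic s` (`ecCellAperiodic_hypotheses_graphFibreVariety`, slice `u = 1`) and is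
torus-ruled, so Theorem B applies. No hypothesis on the degree or leading form of `g`, none on the
leading forms of `A`. [cite: AslanyanKirbyMantova2021, Thm. 1.5] -/
theorem graphFibreVariety_monomial_inter_expGraph_nonempty (hs : 0 < s) (g : MvPolynomial (Fin s) ℂ)
    (haper : ¬ HasIntegerPeriod ℂ (graphBase g))
    (hA : Function.Injective (aeval A : MvPolynomial (Fin s) ℂ →ₐ[ℂ] MvPolynomial (Fin s) ℂ)) :
    (graphFibreVariety g (monomialFibrePoly A κ) ∩ expGraph ℂ (s + 1)).Nonempty := by
  have hP : Function.Injective (aeval (fibreSlice (monomialFibrePoly A κ) 1) :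
      MvPolynomial (Fin s) ℂ →ₐ[ℂ] MvPolynomial (Fin s) ℂ) := by
    rw [fibreSlice_monomialFibrePoly_one]
    exact hA
  obtain ⟨hW, -, hadd, -, -, hbase, haper'⟩ :=
    ecCellAperiodic_hypotheses_graphFibreVariety g (monomialFibrePoly A κ) 1 hP hs haper
  exact inter_expGraph_nonempty_of_isTorusStable_of_not_hasIntegerPeriod hW hadd hbase
    (monomialDir_ne_zero κ) (isTorusStable_graphFibreVariety_monomial A κ g) haper'

/-- **System form**: over an aperiodic graph base (`s ≥ 1`), for dominant `A` and any exponents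
`κ ∈ ℕˢ`, the system `e^{xⱼ} = Aⱼ(x) · e^{κⱼ g(x)}` (`j ≤ s`) has a complex solution.
[cite: AslanyanKirbyMantova2021, Thm. 1.5] -/
theorem exists_exp_eq_mul_exp_pow_of_aperiodic (hs : 0 < s) (g : MvPolynomial (Fin s) ℂ)
    (haper : ¬ HasIntegerPeriod ℂ (graphBase g))
    (hA : Function.Injective (aeval A : MvPolynomial (Fin s) ℂ →ₐ[ℂ] MvPolynomial (Fin s) ℂ)) :
    ∃ x : Fin s → ℂ, ∀ j, Complex.exp (x j) = eval x (A j) * Complex.exp (eval x g) ^ κ j := by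
  have h := graphFibreVariety_monomial_inter_expGraph_nonempty A κ hs g haper hA
  rw [graphFibreVariety_inter_expGraph_nonempty_iff] at h
  obtain ⟨x, hx⟩ := h
  exact ⟨x, fun j => by rw [hx j, eval_cons_monomialFibrePoly]⟩

/-! ## The model over Mantova–Masser's base with proportional fibres -/

/-- **Mantova–Masser's base with proportional fibres**: the 3-fold
`{x₃ = x₁² - x₂², y₁ = x₁ y₃, y₂ = x₂ y₃} ⊆ ℂ³ × ℂ³`, torus-ruled in the direction `(1, 1, 1)` —
isotropic for the quadratic form `x₁² - x₂²`. [cite: MantovaMasser2023, §1 p. 5 (the base of the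
model system of the open case)] -/
def mmProportionalModel : Set (Fin (2 + 1) ⊕ Fin (2 + 1) → ℂ) :=
  graphFibreVariety (X 0 ^ 2 - X 1 ^ 2 : MvPolynomial (Fin 2) ℂ)
    (monomialFibrePoly (X : Fin 2 → MvPolynomial (Fin 2) ℂ) ![1, 1])

/-- `aeval X` is injective (it is the identity). [folklore] -/
theorem aeval_X_injective :
    Function.Injective (aeval (X : Fin s → MvPolynomial (Fin s) ℂ) :
      MvPolynomial (Fin s) ℂ →ₐ[ℂ] MvPolynomial (Fin s) ℂ) := by
  intro p q h
  rwa [aeval_X_left_apply, aeval_X_left_apply] at h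

/-- **The proportional model is a certified member of the aperiodic half of `EC(3,2)`** (binders of
`ECCellAperiodic 2` in order: irreducible closed, meets `G³`, additively free, multiplicatively free,
`dim = 3`, `addProjDim = 2`, aperiodic base) **and is torus-ruled**. [folklore] -/
theorem ecCellAperiodic_hypotheses_mmProportionalModel :
    IsIrreducibleClosed ℂ mmProportionalModel ∧
    (mmProportionalModel ∩ torusLocus ℂ (2 + 1)).Nonempty ∧
    IsAddFree ℂ (2 + 1) (mmProportionalModel ∩ torusLocus ℂ (2 + 1)) ∧
    IsMulFree ℂ (2 + 1) (mmProportionalModel ∩ torusLocus ℂ (2 + 1)) ∧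
    zariskiDim ℂ mmProportionalModel = (2 + 1 : ℕ) ∧
    addProjDim ℂ (2 + 1) mmProportionalModel = (2 : ℕ) ∧
    ¬ HasIntegerPeriod ℂ (projAdd '' (mmProportionalModel ∩ torusLocus ℂ (2 + 1))) ∧
    IsTorusStable (monomialDir ![1, 1]) (mmProportionalModel ∩ torusLocus ℂ (2 + 1)) := by
  have hP : Function.Injective (aeval (fibreSlice
      (monomialFibrePoly (X : Fin 2 → MvPolynomial (Fin 2) ℂ) ![1, 1]) 1) :
      MvPolynomial (Fin 2) ℂ →ₐ[ℂ] MvPolynomial (Fin 2) ℂ) := by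
    rw [fibreSlice_monomialFibrePoly_one]
    exact aeval_X_injective
  obtain ⟨hW, hne, hadd, hmul, hdim, hbase, haper⟩ :=
    ecCellAperiodic_hypotheses_graphFibreVariety (X 0 ^ 2 - X 1 ^ 2 : MvPolynomial (Fin 2) ℂ) _ 1 hP
      two_pos not_hasIntegerPeriod_graphBase_mm
  exact ⟨hW, hne, hadd, hmul, hdim, hbase, haper,
    isTorusStable_graphFibreVariety_monomial _ _ _⟩

/-- **The proportional model meets the graph of `exp`** (Theorem B). [cite: AslanyanKirbyMantova2021,
Thm. 1.5] -/
theorem mmProportionalModel_inter_expGraph_nonempty :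
    (mmProportionalModel ∩ expGraph ℂ (2 + 1)).Nonempty :=
  graphFibreVariety_monomial_inter_expGraph_nonempty _ _ two_pos _ not_hasIntegerPeriod_graphBase_mm
    aeval_X_injective

/-- **Model system over Mantova–Masser's base, proportional fibres**:
`∃ z w ∈ ℂ, e^z = z · e^{z² - w²} ∧ e^w = w · e^{z² - w²}` — equivalently
`e^{z - (z² - w²)} = z`, `e^{w - (z² - w²)} = w`.  The ruling direction `(1,1,1)` is isotropic for
`x₁² - x₂²`, so no escape / puncture / oscillatory theorem of this packet applies; the structural
theorem does. [cite: MantovaMasser2023, §1 p. 5] -/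
theorem mm_proportional_model_system_solvable :
    ∃ z w : ℂ, Complex.exp z = z * Complex.exp (z ^ 2 - w ^ 2) ∧
      Complex.exp w = w * Complex.exp (z ^ 2 - w ^ 2) := by
  obtain ⟨x, hx⟩ := exists_exp_eq_mul_exp_pow_of_aperiodic (X : Fin 2 → MvPolynomial (Fin 2) ℂ)
    ![1, 1] two_pos (X 0 ^ 2 - X 1 ^ 2) not_hasIntegerPeriod_graphBase_mm aeval_X_injective
  refine ⟨x 0, x 1, ?_, ?_⟩
  · have h := hx 0
    simp only [eval_X, map_sub, map_pow, Matrix.cons_val_zero, pow_one] at h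
    exact h
  · have h := hx 1
    simp only [eval_X, map_sub, map_pow, Matrix.cons_val_one, Matrix.cons_val_zero, pow_one] at h
    exact h

end Summit.Schanuel.Schanuel.Theorems
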